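import Summits.HodgeConjecture.HodgeConjecture.Theorems.GenericDivisibilityGenericDivisibilityBoundedLevelCleanFunnel
import Summits.HodgeConjecture.HodgeConjecture.Theorems.GenericDivisibilityGenericDivisibilityBoundedSmallChowZero
import HarnessLib

/-!
# Route GenericDivisibility — crux C2 `GenericDivisibilityBounded` (stmt-HodgeConjecture-18467):
# the heart of line `finite-level-bootstrap` is only needed off the Bloch–Srinivas sector

Line `finite-level-bootstrap`, lead c3 (cycle 5). Companion of
`…GenericDivisibilityBoundedOfOneCleanPrime` (heart ⇒ crux) and `…GenericDivisibilityBoundedSmallChowZero`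
(p157362: C2 and the heart hold at every smooth projective `2p`-fold with `CH₀ ⊗ ℚ` of rank `≤ 1`,
Hodge-free and unconditionally — Bloch–Srinivas):

* `genericDivisibilityBounded_of_oneCleanPrime_off_chowRankLEOneUpTo_zero` — `GenericDivisibilityBounded`
  follows from the existence of ONE clean prime and level on every smooth projective complex `2p`-fold
  (`p ≥ 2`) whose `0`-cycles do NOT have `ℚ`-rank `≤ 1`.

So a refuter of the LINE (not only of the crux) must work on an `X` with `CH₀(X) ⊗ ℚ` of rank `≥ 2`
(the `H^{2p,0} ≠ 0` arena: abelian `2p`-folds, `K3 × K3`, hyper-Kähler / Calabi–Yau), at every prime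
simultaneously (crux workfile HEART-c2.md §F, question Q1).

References: [BlochSrinivas1983] Thm. 1; [ColliotTheleneVoisin2012] Prop. 3.3 (i), §3.1, §4.1;
[VoisinHodgeII2003] Thm. 10.19, Cor. 10.21.
-/

-- `Summit.HodgeConjecture.HodgeConjecture.Theorems` is the mandated namespace (single-problem summit:
-- Problem = Summit), which `linter.dupNamespace` flags on every declaration; the lakefile turns the
-- linter off tree-wide (weak option), restated here so stand-alone elaboration is warning-free too.
set_option linter.dupNamespace false

noncomputable section

namespace Summit.HodgeConjecture.HodgeConjecture.Theorems

open CategoryTheory AlgebraicGeometry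
open Literature.AlgebraicGeometry.Motives Literature.AlgebraicGeometry.HodgeTheory
  Literature.AlgebraicTopology.SingularHomology
open Summit.HodgeConjecture.HodgeConjecture.Theses.GenericDivisibility

/-- **The heart is only needed off the Bloch–Srinivas sector.** `GenericDivisibilityBounded` follows
from the existence of one clean prime and level on every smooth projective complex `2p`-fold (`p ≥ 2`)
whose `0`-cycles do NOT have `ℚ`-rank `≤ 1`: on the sector `ChowRankLEOneUpTo X 0` the crux at `X`
is the theorem `genericDivisibilityBounded_at_of_chowRankLEOneUpTo_zero` (every middle class dies on
one divisor complement; Bloch–Srinivas decomposition of the diagonal, proved in the tree).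
[cite: BlochSrinivas1983, Thm. 1 and its proof] [cite: ColliotTheleneVoisin2012, Prop. 3.3 (i) and §4.1] -/
theorem genericDivisibilityBounded_of_oneCleanPrime_off_chowRankLEOneUpTo_zero
    (hHeart : ∀ ⦃p : ℕ⦄ ⦃X : SchemeOver ℂ⦄, 2 ≤ p → IsSmoothProjective (2 * p) X →
      ¬ ChowRankLEOneUpTo X 0 →
      ∃ ℓ s : ℕ, ℓ.Prime ∧ 1 ≤ s ∧
        ∀ z : singularCohomology ℤ ℤ (ComplexPoints X) (2 * p),
          (∃ Z : Set X.left, IsClosed Z ∧ Z ≠ Set.univ ∧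
            ∃ (y : singularCohomology ℤ ℤ (complexPointsCompl X Z) (2 * p)) (M : ℕ), 1 ≤ M ∧
              M • (singularCohomology.map ℤ ℤ
                (⟨Subtype.val, continuous_subtype_val⟩ : C(complexPointsCompl X Z, ComplexPoints X))
                (2 * p) z - ℓ ^ s • y) = 0) →
          ∃ w : singularCohomology ℤ ℤ (ComplexPoints X) (2 * p),
            ∃ Z : Set X.left, IsClosed Z ∧ Z ≠ Set.univ ∧ ∃ N : ℕ, 1 ≤ N ∧
              N • singularCohomology.map ℤ ℤ
                (⟨Subtype.val, continuous_subtype_val⟩ : C(complexPointsCompl X Z, ComplexPoints X))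
                (2 * p) (z - ℓ • w) = 0) :
    GenericDivisibilityBounded := by
  intro p X hp hX z hz
  by_cases h0 : ChowRankLEOneUpTo X 0
  · exact genericDivisibilityBounded_at_of_chowRankLEOneUpTo_zero hp hX h0 z hz
  rcases Nat.lt_or_ge p 2 with hp2 | hp2
  · obtain rfl : p = 1 := by omega
    exact genericDivisibilityBounded_one hX z hz
  · obtain ⟨ℓ, s, hℓ, hs, hclean⟩ := hHeart hp2 hX h0
    exact genericDivisibilityBounded_at_of_levelClean hX (2 * p) hℓ hs hclean z hz

/-- **C2 itself only needs proof off the Bloch–Srinivas sector**: if the crux holds at every smooth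
projective complex `2p`-fold (`p ≥ 1`) whose `0`-cycles do NOT have `ℚ`-rank `≤ 1`, it holds
everywhere (the sector is the theorem `genericDivisibilityBounded_at_of_chowRankLEOneUpTo_zero`).
[cite: BlochSrinivas1983, Thm. 1 and its proof] [cite: ColliotTheleneVoisin2012, Prop. 3.3 (i)] -/
theorem genericDivisibilityBounded_of_off_chowRankLEOneUpTo_zero
    (h : ∀ ⦃p : ℕ⦄ ⦃X : SchemeOver ℂ⦄, 1 ≤ p → IsSmoothProjective (2 * p) X →
      ¬ ChowRankLEOneUpTo X 0 →
      ∀ z : singularCohomology ℤ ℤ (ComplexPoints X) (2 * p),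
        (∀ m : ℕ, 1 ≤ m → ∃ Z : Set X.left, IsClosed Z ∧ Z ≠ Set.univ ∧
          ∃ y : singularCohomology ℤ ℤ (complexPointsCompl X Z) (2 * p),
            m • y = singularCohomology.map ℤ ℤ
              (⟨Subtype.val, continuous_subtype_val⟩ : C(complexPointsCompl X Z, ComplexPoints X))
              (2 * p) z) →
        singularCohomology.ringChange (Int.castRingHom ℂ) (ComplexPoints X) (2 * p) z ∈
          supportedClasses X (2 * p) 1) :
    GenericDivisibilityBounded := by
  intro p X hp hX z hz
  by_cases h0 : ChowRankLEOneUpTo X 0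
  · exact genericDivisibilityBounded_at_of_chowRankLEOneUpTo_zero hp hX h0 z hz
  · exact h hp hX h0 z hz

/-- **Registered sub-goal `stub_cruxOfOneCleanPrimeOffChowRankLEOneUpToZero` of stmt-HodgeConjecture-18467
(lead c3)**: the sharpened composition of line `finite-level-bootstrap` as a closed statement — one
clean prime and level on every smooth projective `2p`-fold (`p ≥ 2`) with `0`-cycles of `ℚ`-rank `≥ 2`
implies the crux by name. [cite: BlochSrinivas1983, Thm. 1 and its proof]
[cite: ColliotTheleneVoisin2012, §3.1 and §4.1] -/
theorem stub_cruxOfOneCleanPrimeOffChowRankLEOneUpToZero : (∀ ⦃p : ℕ⦄ ⦃X : SchemeOver ℂ⦄, 2 ≤ p → IsSmoothProjective (2 * p) X → ¬ ChowRankLEOneUpTo X 0 → ∃ ℓ s : ℕ, ℓ.Prime ∧ 1 ≤ s ∧ ∀ z : singularCohomology ℤ ℤ (ComplexPoints X) (2 * p), (∃ Z : Set X.left, IsClosed Z ∧ Z ≠ Set.univ ∧ ∃ (y : singularCohomology ℤ ℤ (complexPointsCompl X Z) (2 * p)) (M : ℕ), 1 ≤ M ∧ M • (singularCohomology.map ℤ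 ℤ (⟨Subtype.val, continuous_subtype_val⟩ : C(complexPointsCompl X Z, ComplexPoints X)) (2 * p) z - ℓ ^ s • y) = 0) → ∃ w : singularCohomology ℤ ℤ (ComplexPoints X) (2 * p), ∃ Z : Set X.left, IsClosed Z ∧ Z ≠ Set.univ ∧ ∃ N : ℕ, 1 ≤ N ∧ N • singularCohomology.map ℤ ℤ (⟨Subtype.val, continuous_subtype_val⟩ : C(complexPointsCompl X Z, ComplexPoints X)) (2 * p) (z - ℓ • w) = 0) → Summit.HodgeConjecture.HodgeConjecture.Theses.GenericDivisibility.GenericDivisibilityBounded :=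
  fun hHeart ↦ genericDivisibilityBounded_of_oneCleanPrime_off_chowRankLEOneUpTo_zero hHeart

end Summit.HodgeConjecture.HodgeConjecture.Theorems

end
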